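import Summits.QuantumAdvantage.AdviceFreeQNC0.MassInequalityK
import HarnessLib

/-!
# Cell qa-qnc0 (rung F-Q1, density axis): the DISJOINT DOMINATION CERTIFICATE at block size `m = 7`
# (`domSeven : DomSeven`, Sketch13 v6e; planner qa-qnc0-p1 ROUND-12 §2.10 (xi-q), kit13/domcert_m7.txt)

The optimal symmetric codeword of the single-block eliminator code `C_7` is `K0(u) = [2 ≤ |u| ≤ 5]`
(triple `T₀ = parity`, `T₁ = 1 + parity`, `T₂ = 1`; zero set `Z = {|u| ∈ {0,1,6,7}}`, `|Z| = 16 = w(7,1)`).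
The planner's certificate gives every `z ∈ Z` a 6-point set `R z` OUTSIDE `Z` such that
`A(z) = ⊕_{u ∈ R z} A(u)` for every codeword `A`, the 16 sets pairwise disjoint.  PROVED here:

* `Dom7.rel_holds` — the relations hold for every codeword: the pattern map `(T₀,T₁) ↦ A` is `𝔽₂`-linear, so it
  suffices to check the 16 generators `(x^S, 0)`, `(0, x^S)` (`|S| ≤ 1`) of `lowDeg 1 × lowDeg 1` — a `decide`;
* `Dom7.isOpt1_K0` — OPTIMALITY comes from the same certificate: the 16 sets `{z} ∪ R z` are pairwise disjoint
  ODD dual words, so every codeword has a zero in each of them, `failCount ≥ 16 = failCount K0`;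
* **`domSeven : DomSeven`** — hence, with `domPays` (`MassInequalityK.lean`), the mass inequality
  `MassIneqK 7 k K0` holds at EVERY level `k` (`massIneqK_seven`); with the recursion `MassIneqKPays 7` (not
  in this file) this is exact tensor multiplicativity `W_k(7,1) = 16^k` (`exactMultSeven_of`).

WHAT THIS IS NOT: `16/128 = 1/8 < 1/4` — no payoff at `m = 7` (and `W_k(7,1) = 16^k` is also LP-forced, planner
12:08Z); the point is an LP-free certificate for the mass inequality itself; `MassIneqKPays` is not proved here;
MULT₁ at paying block sizes is OPEN; separation NOT moved.
-/

namespace Summit.QuantumAdvantage.AdviceFreeQNC0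

open Finset
open Literature.Computability.MetaComplexity Literature.Computability.MetaComplexity.Smolensky

namespace MassInequality

namespace Dom7

/-! ### The data -/

/-- The optimal symmetric codeword at `m = 7`: `K0(u) = [2 ≤ |u| ≤ 5]`. -/
def K0 (u : Fin 7 → Bool) : Bool := decide (2 ≤ wt u ∧ wt u ≤ 5)

/-- The 16 inside points `z` (weights `0,1,6,7`) with their 6-point outside relations (kit13/domcert_m7.txt). -/
def table7 : List ((Fin 7 → Bool) × List (Fin 7 → Bool)) := [
  (![false, false, false, false, false, false, false], [![false, false, false, false, true, true, true], ![false, false, true, false, false, true, false], ![false, false, true, false, true, false, true], ![false, false, true, true, true, true, false], ![true, false, true, false, true, true, false], ![true, false, true, true, false, true, false]]),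
  (![false, false, false, false, false, false, true], [![false, false, true, true, false, true, false], ![false, true, true, false, true, true, true], ![true, false, false, false, true, false, true], ![true, false, false, false, true, true, true], ![true, true, false, true, false, false, false], ![true, true, true, false, false, false, true]]),
  (![false, false, false, false, false, true, false], [![false, false, false, false, true, true, false], ![false, true, false, false, true, false, false], ![false, true, true, true, false, false, true], ![true, false, true, true, false, false, false], ![true, true, false, false, false, true, true], ![true, true, true, true, false, true, false]]),
  (![false, false, false, false, true, false, false], [![false, true, false, false, false, true, true], ![false, true, false, true, false, true, true], ![false, true, false, true, true, false, false], ![true, false, true, false, false, true, false], ![true, false, true, true, true, false, true], ![true, true, true, false, false, true, false]]),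
  (![false, false, false, true, false, false, false], [![false, false, false, false, false, true, true], ![false, false, false, true, true, false, false], ![false, true, true, true, false, true, false], ![true, false, true, false, true, false, false], ![true, false, true, true, false, true, true], ![true, true, false, false, true, true, false]]),
  (![false, false, true, false, false, false, false], [![false, true, true, false, true, false, true], ![true, false, false, true, true, false, false], ![true, false, false, true, true, true, true], ![true, true, false, true, false, false, true], ![true, true, true, false, true, false, true], ![true, true, true, false, true, true, false]]),
  (![false, true, false, false, false, false, false], [![false, true, false, false, true, true, true], ![true, false, false, true, false, true, false], ![true, false, false, true, true, false, true], ![true, false, true, true, true, true, false], ![true, true, false, true, true, false, true], ![true, true, true, true, false, false, true]]),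
  (![false, true, true, true, true, true, true], [![false, false, true, true, true, false, false], ![false, false, true, true, true, true, true], ![false, true, false, false, false, true, false], ![true, false, false, true, false, false, true], ![true, false, true, false, true, true, true], ![true, true, false, true, false, true, false]]),
  (![true, false, false, false, false, false, false], [![false, false, false, true, false, true, false], ![false, true, true, false, false, false, false], ![true, false, false, false, true, true, false], ![true, false, true, false, false, true, true], ![true, false, true, false, true, false, true], ![true, true, true, true, true, false, false]]),
  (![true, false, true, true, true, true, true], [![false, false, true, true, false, false, false], ![false, false, true, true, false, false, true], ![false, true, false, true, false, false, false], ![false, true, true, false, false, true, false], ![true, false, false, false, true, false, false], ![true, true, true, false, true, false, false]]),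
  (![true, true, false, true, true, true, true], [![false, false, false, true, true, true, false], ![false, true, false, true, true, false, true], ![false, true, true, false, false, false, true], ![false, true, true, false, false, true, true], ![true, false, false, true, true, true, false], ![true, false, true, false, false, false, false]]),
  (![true, true, true, false, true, true, true], [![false, false, true, false, false, true, true], ![false, false, true, false, true, true, true], ![false, false, true, true, true, false, true], ![false, true, false, false, true, false, true], ![true, false, false, false, false, false, true], ![true, false, false, true, false, true, true]]),
  (![true, true, true, true, false, true, true], [![false, true, false, true, true, true, true], ![false, true, true, true, true, true, false], ![true, false, false, false, false, true, true], ![true, false, false, true, false, false, false], ![true, false, true, true, false, false, true], ![true, true, false, false, false, false, true]]),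
  (![true, true, true, true, true, false, true], [![false, true, false, false, false, false, true], ![false, true, false, true, true, true, false], ![false, true, true, false, true, true, false], ![false, true, true, true, false, true, true], ![true, true, false, false, true, false, true], ![true, true, false, false, true, true, true]]),
  (![true, true, true, true, true, true, false], [![false, false, false, true, false, false, true], ![false, false, false, true, false, true, true], ![false, false, false, true, true, false, true], ![false, false, true, false, false, false, true], ![true, true, false, false, false, false, false], ![true, true, true, true, false, false, false]]),
  (![true, true, true, true, true, true, true], [![false, false, false, true, true, true, true], ![false, false, true, true, false, true, true], ![false, true, false, false, true, true, false], ![false, true, false, true, false, false, true], ![true, true, false, false, true, false, false], ![true, true, false, true, false, true, true]])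
]


/-- The outside relation of an inside point, as a list (empty elsewhere). -/
def Rl (z : Fin 7 → Bool) : List (Fin 7 → Bool) :=
  ((table7.filter fun e => e.1 = z).map fun e => e.2).flatten

/-- The outside relation of an inside point (empty elsewhere). -/
def R (z : Fin 7 → Bool) : Finset (Fin 7 → Bool) := (Rl z).toFinset

/-- List-level facts of the certificate (finite check): outside-ness, no duplicates, size `6`, and the inside
point is not in its own relation. -/
theorem lists_check : ∀ z : Fin 7 → Bool, K0 z = false →
    (∀ u ∈ Rl z, K0 u = true) ∧ (Rl z).Nodup ∧ (Rl z).length = 6 := by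
  unfold Rl K0 wt table7
  decide +kernel

/-- Pairwise separation of the certificate sets (finite check). -/
theorem sep_check : ∀ z z' : Fin 7 → Bool, K0 z = false → K0 z' = false → z ≠ z' →
    z ∉ Rl z' ∧ ∀ u ∈ Rl z, u ≠ z' ∧ u ∉ Rl z' := by
  unfold Rl K0 wt table7
  decide +kernel

/-- Sums over `R z` are list sums. -/
theorem sum_R {z : Fin 7 → Bool} (hz : K0 z = false) (f : (Fin 7 → Bool) → ZMod 2) :
    ∑ u ∈ R z, f u = ((Rl z).map f).sum := by
  unfold R
  exact List.sum_toFinset f (lists_check z hz).2.1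

/-- `#(R z) = 6`. -/
theorem card_R {z : Fin 7 → Bool} (hz : K0 z = false) : (R z).card = 6 := by
  unfold R
  rw [List.toFinset_card_of_nodup (lists_check z hz).2.1, (lists_check z hz).2.2]

/-! ### The codeword `K0` -/

/-- The triple of `K0`: `T₀ = parity`, `T₁ = 1 + parity`, `T₂ = 1`. -/
def T0 (r : ℕ) (u : Fin 7 → Bool) : Bool :=
  if r = 0 then decide (wt u % 2 = 1) else if r = 1 then !decide (wt u % 2 = 1) else true

/-- Parity has `𝔽₂`-degree `1`: its indicator is `Σ_i x_i`. -/
theorem hasDeg_parity : HasDeg (fun u : Fin 7 → Bool => decide (wt u % 2 = 1)) 1 := by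
  unfold HasDeg
  have heq : (fun x : Fin 7 → Bool => if decide (wt x % 2 = 1) = true then (1 : ZMod 2) else 0) =
      ∑ i : Fin 7, mono (ZMod 2) {i} := by
    funext x
    rw [Finset.sum_apply]
    have h1 : ∀ i : Fin 7, mono (ZMod 2) {i} x = if x i = true then 1 else 0 := fun i => by
      rw [mono_apply]; simp
    simp only [h1]
    rw [← Finset.sum_filter, sum_const, nsmul_eq_mul, mul_one]
    unfold wt
    rcases Nat.mod_two_eq_zero_or_one ((univ.filter fun i : Fin 7 => x i = true).card) with h | h
    · rw [h]
      have : (((univ.filter fun i : Fin 7 => x i = true).card : ℕ) : ZMod 2) = 0 :=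
        (ZMod.natCast_eq_zero_iff_even).2 (Nat.even_iff.2 h)
      rw [this]; simp
    · rw [h]
      have : (((univ.filter fun i : Fin 7 => x i = true).card : ℕ) : ZMod 2) = 1 :=
        (ZMod.natCast_eq_one_iff_odd).2 (Nat.odd_iff.2 h)
      rw [this]; simp
  rw [heq]
  exact Submodule.sum_mem _ fun i _ => mono_mem_lowDeg (by simp)

/-- The constant `true` has degree `≤ 1`. -/
theorem hasDeg_true7 : HasDeg (fun _ : Fin 7 → Bool => true) 1 := by
  unfold HasDeg
  have : (fun _ : Fin 7 → Bool => if true = true then (1 : ZMod 2) else 0) = mono (ZMod 2) (∅ : Finset (Fin 7)) := by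
    funext x; simp
  rw [this]; exact mono_mem_lowDeg (by simp)

/-- `1 + parity` has degree `1`. -/
theorem hasDeg_not_parity : HasDeg (fun u : Fin 7 → Bool => !decide (wt u % 2 = 1)) 1 := by
  have h := hasDeg_xor (hasDeg_parity) hasDeg_true7
  have heq : (fun u : Fin 7 → Bool => !decide (wt u % 2 = 1)) =
      fun u => xor (decide (wt u % 2 = 1)) true := by
    funext u; cases decide (wt u % 2 = 1) <;> rfl
  rw [heq]; exact h

/-- `K0 ∈ C_7`. -/
theorem isElim1_K0 : IsElim1 7 K0 := by
  refine ⟨T0, fun r => ?_, fun u => ?_, fun u => ?_⟩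
  · unfold T0
    by_cases h0 : r = 0
    · simp only [h0, if_true]; exact hasDeg_parity
    · by_cases h1 : r = 1
      · simp only [h1, if_true, show (1 : ℕ) ≠ 0 from one_ne_zero, if_false]; exact hasDeg_not_parity
      · simp only [h0, h1, if_false]; exact hasDeg_true7
  · unfold T0
    simp only [if_true, show (1 : ℕ) ≠ 0 from one_ne_zero, if_false, show (2 : ℕ) ≠ 0 from two_ne_zero,
      show (2 : ℕ) ≠ 1 from by norm_num]
    cases decide (wt u % 2 = 1) <;> rfl
  · -- `K0 u = T0 (|u| mod 3) u`: a function of `|u| ≤ 7` only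
    unfold K0 T0
    have h7 : wt u ≤ 7 := by
      unfold wt; exact (card_le_univ _).trans (by simp)
    generalize wt u = w at h7
    interval_cases w <;> simp

/-- `failCount K0 = 16`. -/
theorem failCount_K0 : failCount K0 = 16 := by
  unfold failCount K0 wt; decide +kernel

/-! ### The relations -/

/-- The pattern of the pair `(p, q)` read by `|u| mod 3` (with `T₂ = T₀ + T₁`), in `𝔽₂`. -/
def patZ (p q : CubeFn (ZMod 2) 7) (u : Fin 7 → Bool) : ZMod 2 :=
  if wt u % 3 = 0 then p u else if wt u % 3 = 1 then q u else p u + q u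

/-- The relation of `z` evaluated on the pair `(p, q)`: `pat(z) + Σ_{u ∈ R z} pat(u)`. -/
def relZ (z : Fin 7 → Bool) (p q : CubeFn (ZMod 2) 7) : ZMod 2 := patZ p q z + ∑ u ∈ R z, patZ p q u

/-- `relZ` splits over the pair. -/
theorem relZ_split (z : Fin 7 → Bool) (p q : CubeFn (ZMod 2) 7) : relZ z p q = relZ z p 0 + relZ z 0 q := by
  unfold relZ
  have h : ∀ u, patZ p q u = patZ p 0 u + patZ 0 q u := fun u => by
    unfold patZ; split_ifs <;> simp
  rw [h, Finset.sum_congr rfl fun u _ => h u, sum_add_distrib]; ring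

/-- `relZ z · 0` is additive. -/
theorem relZ_add_left (z : Fin 7 → Bool) (p p' : CubeFn (ZMod 2) 7) :
    relZ z (p + p') 0 = relZ z p 0 + relZ z p' 0 := by
  unfold relZ
  have h : ∀ u, patZ (p + p') 0 u = patZ p 0 u + patZ p' 0 u := fun u => by
    unfold patZ; split_ifs <;> simp
  rw [h, Finset.sum_congr rfl fun u _ => h u, sum_add_distrib]; ring

/-- `relZ z 0 ·` is additive. -/
theorem relZ_add_right (z : Fin 7 → Bool) (q q' : CubeFn (ZMod 2) 7) :
    relZ z 0 (q + q') = relZ z 0 q + relZ z 0 q' := by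
  unfold relZ
  have h : ∀ u, patZ 0 (q + q') u = patZ 0 q u + patZ 0 q' u := fun u => by
    unfold patZ; split_ifs <;> simp
  rw [h, Finset.sum_congr rfl fun u _ => h u, sum_add_distrib]; ring

/-- `relZ z (c • p) 0 = c * relZ z p 0`, and on the right. -/
theorem relZ_smul_left (z : Fin 7 → Bool) (c : ZMod 2) (p : CubeFn (ZMod 2) 7) :
    relZ z (c • p) 0 = c * relZ z p 0 := by
  unfold relZ
  have h : ∀ u, patZ (c • p) 0 u = c * patZ p 0 u := fun u => by
    unfold patZ; split_ifs <;> simp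
  rw [h, Finset.sum_congr rfl fun u _ => h u, ← mul_sum]; ring

/-- `relZ z 0 (c • q) = c * relZ z 0 q`. -/
theorem relZ_smul_right (z : Fin 7 → Bool) (c : ZMod 2) (q : CubeFn (ZMod 2) 7) :
    relZ z 0 (c • q) = c * relZ z 0 q := by
  unfold relZ
  have h : ∀ u, patZ 0 (c • q) u = c * patZ 0 q u := fun u => by
    unfold patZ; split_ifs <;> simp
  rw [h, Finset.sum_congr rfl fun u _ => h u, ← mul_sum]; ring

/-- The generator check in list form (finite, by `decide`): every relation kills every monomial of degree
`≤ 1` on either side. -/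
theorem gens_check_list : ∀ z : Fin 7 → Bool, K0 z = false →
    ∀ S ∈ (univ : Finset (Finset (Fin 7))).filter (fun S => S.card ≤ 1),
      patZ (mono (ZMod 2) S) 0 z + ((Rl z).map (patZ (mono (ZMod 2) S) 0)).sum = 0 ∧
        patZ 0 (mono (ZMod 2) S) z + ((Rl z).map (patZ 0 (mono (ZMod 2) S))).sum = 0 := by
  unfold patZ Rl K0 mono wt table7
  decide +kernel

/-- The generator check: every relation kills every monomial of degree `≤ 1` on either side. -/
theorem gens_check : ∀ z : Fin 7 → Bool, K0 z = false →
    ∀ S ∈ (univ : Finset (Finset (Fin 7))).filter (fun S => S.card ≤ 1),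
      relZ z (mono (ZMod 2) S) 0 = 0 ∧ relZ z 0 (mono (ZMod 2) S) = 0 := by
  intro z hz S hS
  unfold relZ
  rw [sum_R hz, sum_R hz]
  exact gens_check_list z hz S hS

/-- Every relation kills every degree-`≤ 1` function on the left … -/
theorem relZ_left_of_lowDeg {z : Fin 7 → Bool} (hz : K0 z = false) {p : CubeFn (ZMod 2) 7}
    (hp : p ∈ lowDeg (ZMod 2) 7 1) : relZ z p 0 = 0 := by
  rw [lowDeg_eq_span] at hp
  induction hp using Submodule.span_induction with
  | mem x hx =>
    obtain ⟨⟨S, hS⟩, rfl⟩ := hx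
    exact (gens_check z hz S (mem_filter.2 ⟨mem_univ _, hS⟩)).1
  | zero => unfold relZ patZ; simp
  | add x y _ _ hx hy => rw [relZ_add_left, hx, hy, add_zero]
  | smul c x _ hx => rw [relZ_smul_left, hx, mul_zero]

/-- … and on the right. -/
theorem relZ_right_of_lowDeg {z : Fin 7 → Bool} (hz : K0 z = false) {q : CubeFn (ZMod 2) 7}
    (hq : q ∈ lowDeg (ZMod 2) 7 1) : relZ z 0 q = 0 := by
  rw [lowDeg_eq_span] at hq
  induction hq using Submodule.span_induction with
  | mem x hx =>
    obtain ⟨⟨S, hS⟩, rfl⟩ := hx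
    exact (gens_check z hz S (mem_filter.2 ⟨mem_univ _, hS⟩)).2
  | zero => unfold relZ patZ; simp
  | add x y _ _ hx hy => rw [relZ_add_right, hx, hy, add_zero]
  | smul c x _ hx => rw [relZ_smul_right, hx, mul_zero]

/-- **The relations hold for every codeword**: `A(z) ↔ #(R z ∩ supp A)` odd. -/
theorem rel_holds {z : Fin 7 → Bool} (hz : K0 z = false) {A : (Fin 7 → Bool) → Bool} (hA : IsElim1 7 A) :
    A z = true ↔ Odd ((R z).filter (fun u => A u = true)).card := by
  obtain ⟨T, hT, hTe, hTA⟩ := hA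
  set p : CubeFn (ZMod 2) 7 := fun u => if T 0 u = true then 1 else 0 with hp
  set q : CubeFn (ZMod 2) 7 := fun u => if T 1 u = true then 1 else 0 with hq
  have hpat : ∀ u, (if A u = true then (1 : ZMod 2) else 0) = patZ p q u := by
    intro u
    rw [hTA u]
    unfold patZ
    have h3 : wt u % 3 < 3 := Nat.mod_lt _ (by norm_num)
    have hev := hTe u
    generalize wt u % 3 = r at h3
    interval_cases r
    · simp [hp]
    · simp [hq]
    · simp only [hp, hq, show (2 : ℕ) = 0 ↔ False from by norm_num, show (2 : ℕ) = 1 ↔ False from by norm_num,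
        if_false]
      revert hev
      cases T 0 u <;> cases T 1 u <;> cases T 2 u <;> decide
  have hrel : relZ z p q = 0 := by
    rw [relZ_split, relZ_left_of_lowDeg hz (hT 0), relZ_right_of_lowDeg hz (hT 1), add_zero]
  unfold relZ at hrel
  rw [← hpat z, Finset.sum_congr rfl fun u _ => (hpat u).symm, ← Finset.sum_filter] at hrel
  simp only [sum_const, nsmul_eq_mul, mul_one] at hrel
  -- `[A z] + #filter = 0` in `𝔽₂`
  rw [← ZMod.natCast_eq_one_iff_odd]
  constructor
  · intro h
    rw [h, if_pos rfl] at hrel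
    have : (((filter (fun u => A u = true) (R z)).card : ℕ) : ZMod 2) = -1 := by
      linear_combination hrel
    rw [this]; decide
  · intro h
    rw [h] at hrel
    by_contra hne
    rw [if_neg hne] at hrel
    exact absurd hrel (by decide)

/-! ### Disjointness, outside-ness, optimality -/

/-- The relation sets live outside `Z` and have `6` elements; the sets `{z} ∪ R z` are pairwise disjoint. -/
theorem sets_check :
    (∀ z : Fin 7 → Bool, K0 z = false → (∀ u ∈ R z, K0 u = true) ∧ (R z).card = 6) ∧
    (∀ z z' : Fin 7 → Bool, K0 z = false → K0 z' = false → z ≠ z' →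
      Disjoint (insert z (R z)) (insert z' (R z'))) := by
  refine ⟨fun z hz => ⟨fun u hu => (lists_check z hz).1 u (List.mem_toFinset.1 hu), card_R hz⟩,
    fun z z' hz hz' hne => ?_⟩
  obtain ⟨hzz', hsep⟩ := sep_check z z' hz hz' hne
  rw [Finset.disjoint_left]
  intro u hu hu'
  rw [mem_insert] at hu hu'
  unfold R at hu hu'
  rw [List.mem_toFinset] at hu hu'
  rcases hu with rfl | hu
  · rcases hu' with h | h
    · exact hne h
    · exact hzz' h
  · rcases hu' with rfl | h
    · exact (hsep _ hu).1 rfl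
    · exact (hsep _ hu).2 h

/-- Every codeword has a zero in each certificate set `{z} ∪ R z`. -/
theorem exists_zero {A : (Fin 7 → Bool) → Bool} (hA : IsElim1 7 A) {z : Fin 7 → Bool} (hz : K0 z = false) :
    ∃ u ∈ insert z (R z), A u = false := by
  by_cases hAz : A z = true
  · have hodd := (rel_holds hz hA).1 hAz
    by_contra hall
    push Not at hall
    have hfull : (R z).filter (fun u => A u = true) = R z := by
      refine filter_true_of_mem fun u hu => ?_
      have := hall u (mem_insert_of_mem hu)
      cases hAu : A u
      · exact absurd hAu this
      · rfl
    rw [hfull, (sets_check.1 z hz).2] at hodd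
    exact absurd hodd (by decide)
  · exact ⟨z, mem_insert_self _ _, by cases h : A z <;> simp_all⟩

/-- **Optimality of `K0` from the certificate**: every codeword has at least `16` zeros. -/
theorem isOpt1_K0 : IsOpt1 7 K0 := by
  classical
  refine ⟨isElim1_K0, fun X hX => ?_⟩
  rw [failCount_K0]
  -- choose a zero of `X` in each certificate set
  have hch : ∀ z : Fin 7 → Bool, ∃ u : Fin 7 → Bool, K0 z = false → u ∈ insert z (R z) ∧ X u = false := by
    intro z
    by_cases hz : K0 z = false
    · obtain ⟨u, hu, hXu⟩ := exists_zero hX hz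
      exact ⟨u, fun _ => ⟨hu, hXu⟩⟩
    · exact ⟨z, fun h => absurd h hz⟩
  choose g hg using hch
  have hZ : (univ.filter fun z : Fin 7 → Bool => K0 z = false).card = 16 := by
    have := failCount_K0
    unfold failCount at this
    exact this
  rw [← hZ]
  unfold failCount
  refine card_le_card_of_injOn g (fun z hz => ?_) (fun z hz z' hz' h => ?_)
  · rw [mem_coe, mem_filter] at hz ⊢
    exact ⟨mem_univ _, (hg z hz.2).2⟩
  · rw [mem_coe, mem_filter] at hz hz'
    by_contra hne
    have hd := sets_check.2 z z' hz.2 hz'.2 hne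
    exact disjoint_left.1 hd (hg z hz.2).1 (h ▸ (hg z' hz'.2).1)

end Dom7

/-- **`DomSeven` — PROVED** (the disjoint domination certificate at `m = 7`, with the optimality of `K0`). -/
theorem domSeven : DomSeven :=
  ⟨Dom7.K0, Dom7.isOpt1_K0, Dom7.failCount_K0, Dom7.R,
    fun z hz => ⟨(Dom7.sets_check.1 z hz).1, fun _ hA => Dom7.rel_holds hz hA⟩,
    fun z z' hz hz' hne =>
      Disjoint.mono (subset_insert _ _) (subset_insert _ _) (Dom7.sets_check.2 z z' hz hz' hne)⟩

/-- Hence the mass inequality holds at `m = 7` at EVERY level, for the optimal codeword `K0`. -/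
theorem massIneqK_seven : ∀ k, 0 < k → MassIneqK 7 k Dom7.K0 :=
  domPays 7 Dom7.K0 ⟨Dom7.R, fun z hz => ⟨(Dom7.sets_check.1 z hz).1, fun _ hA => Dom7.rel_holds hz hA⟩,
    fun z z' hz hz' hne =>
      Disjoint.mono (subset_insert _ _) (subset_insert _ _) (Dom7.sets_check.2 z z' hz hz' hne)⟩

/-- And exact multiplicativity at `m = 7` hangs on the recursion `MassIneqKPays 7` alone. -/
theorem exactMultSeven_of_massIneqKPays (h : MassIneqKPays 7) : ExactMultSeven :=
  exactMultSeven_of domSeven (domPays 7) h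

end MassInequality

end Summit.QuantumAdvantage.AdviceFreeQNC0
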